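import Summits.QuantumFields.BalabanUV.T4Continuum.Support.FirstOrderAdjointModel

/-!
# T⁴ programme, spine node NE2 (U1a) — THE ABELIAN COVARIANT LAPLACIAN: `Δ^U − Δ = F + Fᴴ + diag z` EXACTLY, and the η-rate of the
# unit-lattice covariance of `(Δ_a + t(Δ^U − Δ))⁻¹` for a C²-small abelian connection

Ninth generation of the NE2 prover lineage P1 of the cell `pub-balaban`, file 14 (on top of file 13).  The first instance of the
resolvent route in which the perturbation is LITERALLY a covariant Laplacian minus the free one (not an ad hoc model):

 * §1 the covariant forward difference `(∇^U_ν f)_μ(x) = c·(u_ν(x, μ)·f_μ(x + e_ν) − f_μ(x))` (`covD`, parallel transporter `u_ν`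
   on the bond `(x, x + e_ν)`, lattice factor `c = η⁻¹`; `covD … 1 ν = ∇_ν`), the connection in lattice units
   `w_ν = c·(u_ν − 1)` (`conn`; for `u = e^{iη𝒜}`: `w ≈ i𝒜`), `covD = ∇ + diag(w)·S` (`covD_eq`), the abelian covariant vector
   Laplacian `Δ^U = Σ_ν (∇^U_ν)ᴴ∇^U_ν` (`covLap`) and the free one `Δ^1 = Σ_ν ∇_νᴴ∇_ν` (`lap`, `covLap_one`);
 * §2 (real lattice factor `c = n`) the exact identities `∇ᴴ·diag(w)·S = −diag(w)∇ − c·(diag w − diag w₋)` (`w₋ = w ∘ τ⁻¹`,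
   **`fdiffH_mul_diag_shift`**), `(diag(w)S)ᴴ(diag(w)S) = diag(|w|² ∘ τ⁻¹)`, and **`covLap_sub_lap_eq`**:
   `Δ^U − Δ^1 = F + Fᴴ + diag z`, `F = Σ_ν diag(−w_ν)∇_ν` (`FirstOrderBackgroundModel.firstOrder`),
   `z = Σ_ν [|w_ν|²∘τ_ν⁻¹ − c(w_ν − w_ν∘τ_ν⁻¹) − c(w̄_ν − w̄_ν∘τ_ν⁻¹)]` (`zfield`);
 * §3 along the tower (`covPert u k = Δ^{U_k} − Δ^1` at spacing `L^{−k}`): **`perturbationLaws_covariantLaplacian`** — for a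
   connection whose lattice-unit field `−w^{(k)}` is a `LipschitzBackground (α, β)` and whose zeroth-order field `z^{(k)}` is a
   `BoundedBackground (α′, β′)` (C² data), `PerturbationLaws` hold with `κ = 2d(α + β)Cst + α′Cst`; hence
   **`towerLimitRate_covariantLaplacian`** (all `‖t‖κ < 1`) and, in the small-field regime `κ < 1`, the η-RATE AT `t = 1`:
   **`covariantLaplacian_rate`** for the King-averaged unit-lattice covariances of `(Δ_a^{(k)} + (Δ^{U_k} − Δ^1))⁻¹`.

HONEST FRAMING (T4-DAG p. 1).  `Δ^1 = Σ∇ᴴ∇` is the standard nearest-neighbour vector Laplacian written in position space; that it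
coincides entry-wise with the Laplacian summand of the tree's spectrally defined `calDa` is NOT proved here, so `Δ_a + (Δ^U − Δ^1)`
is "Δ_a with covariantized Laplacian" only in that sense; ABELIAN (diagonal transporters), global small field (`κ < 1`), no
`−∂P∂*`/`aQ*Q` covariantization, finite torus, linear layer, operator norm; rates / constants OURS; NOT Bałaban's (3.23)–(3.24);
NOT infinite volume / mass gap / Clay / summit progress; spine 0/9 unchanged.  HONEST DEPENDENCY: continuum YM on T⁴ ⇐
BetaPertH ∧ nine spine estimates (0/9 proved); BetaPertH ⇐ (D1) ∧ (D4) ∧ CAP+tail; G-an2-4 gates asym, D1 and NE2/3/4.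
ABSOLUTE RULE kept; no `sorry`.
-/

noncomputable section

open scoped BigOperators ComplexConjugate Matrix Matrix.Norms.L2Operator
open Filter Topology

namespace Summit.QuantumFields.BalabanUV.T4Continuum.AbelianCovariantLaplacian

open Literature.MathematicalPhysics.QuantumFieldTheory.Balaban1983to89.B5Prop11Plancherel
open Literature.MathematicalPhysics.QuantumFieldTheory.Balaban1983to89.B5G183RateTorusW
open Literature.MathematicalPhysics.QuantumFieldTheory.Balaban1983to89.B5G183RateUnitTower (lev lev_neZero)
open Summit.QuantumFields.BalabanUV.T4Continuum
open Summit.QuantumFields.BalabanUV.T4Continuum.CovariantAveragingTower (TowerLimitRate)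
open Summit.QuantumFields.BalabanUV.T4Continuum.BalabanAveragedTowerUnit (idx Qlev calGlev one_le_lev' cast_lev')
open Summit.QuantumFields.BalabanUV.T4Continuum.BackgroundResolventTower
open Summit.QuantumFields.BalabanUV.T4Continuum.KingPairingPlantedLaw
open Summit.QuantumFields.BalabanUV.T4Continuum.BlockPairingGeometry
open Summit.QuantumFields.BalabanUV.T4Continuum.NE2PerturbedLayer
open Summit.QuantumFields.BalabanUV.T4Continuum.FirstOrderBackgroundModel
open Summit.QuantumFields.BalabanUV.T4Continuum.PerturbationAlgebra
open Summit.QuantumFields.BalabanUV.T4Continuum.FirstOrderAdjointModel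

variable {d : ℕ}

/-! ## §1 Covariant differences and Laplacians -/

section OneLevel

variable (Nf : Fin d → ℕ) [hNf : ∀ μ, NeZero (Nf μ)]

/-- inverse unit translation `τ_μ⁻¹(x, ν) = (x − e_μ, ν)`. [folklore] -/
def tauInv (μ : Fin d) (i : Tor Nf × Fin d) : Tor Nf × Fin d := (i.1 - unitVec Nf μ, i.2)

omit hNf in
/-- `τ_μ⁻¹ ∘ τ_μ = id`. [folklore] -/
@[simp] theorem tauInv_tau (μ : Fin d) (i : Tor Nf × Fin d) : tauInv Nf μ (tau Nf μ i) = i :=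
  Prod.ext (add_sub_cancel_right _ _) rfl

omit hNf in
/-- `τ_μ ∘ τ_μ⁻¹ = id`. [folklore] -/
@[simp] theorem tau_tauInv (μ : Fin d) (i : Tor Nf × Fin d) : tau Nf μ (tauInv Nf μ i) = i :=
  Prod.ext (sub_add_cancel _ _) rfl

/-- `S_μᴴ·diag(v)·S_μ = diag(v ∘ τ_μ⁻¹)`. [folklore] -/
theorem conjTranspose_shiftM_mul_diagonal_mul_shiftM (μ : Fin d) (v : Tor Nf × Fin d → ℂ) :
    (shiftM Nf μ)ᴴ * (Matrix.diagonal v * shiftM Nf μ) = Matrix.diagonal (fun i => v (tauInv Nf μ i)) := by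
  have h := shiftM_mul_diagonal Nf μ (fun i => v (tauInv Nf μ i))
  have e : ((fun i => v (tauInv Nf μ i)) ∘ tau Nf μ) = v := funext fun i => by simp only [Function.comp_apply, tauInv_tau]
  rw [e] at h
  rw [← h, ← Matrix.mul_assoc, conjTranspose_shiftM_mul, Matrix.one_mul]

/-- **the covariant forward difference** `(∇^U_ν f)_μ(x) = c·(u_ν(x, μ) f_μ(x + e_ν) − f_μ(x))` with parallel transporters `u_ν`
(abelian: diagonal). [cite: Balaban1985BackgroundPropagators, (3.3) p.390 (covariant derivative)] [folklore] -/
def covD (c : ℂ) (u : Fin d → (Tor Nf × Fin d → ℂ)) (ν : Fin d) : Matrix (Tor Nf × Fin d) (Tor Nf × Fin d) ℂ :=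
  c • (Matrix.diagonal (u ν) * shiftM Nf ν - 1)

/-- the connection in lattice units `w_ν = c·(u_ν − 1)` (for `u = e^{iη𝒜}`, `c = η⁻¹`: `w = i𝒜 + O(η𝒜²)`). [folklore] -/
def conn (c : ℂ) (u : Fin d → (Tor Nf × Fin d → ℂ)) (ν : Fin d) : Tor Nf × Fin d → ℂ := fun i => c * (u ν i - 1)

/-- `∇^U_ν = ∇_ν + diag(w_ν)·S_ν`. [folklore] -/
theorem covD_eq (c : ℂ) (u : Fin d → (Tor Nf × Fin d → ℂ)) (ν : Fin d) :
    covD Nf c u ν = fdiff Nf c ν + Matrix.diagonal (conn Nf c u ν) * shiftM Nf ν := by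
  have e : Matrix.diagonal (conn Nf c u ν) = c • (Matrix.diagonal (u ν) - 1) := by
    rw [← Matrix.diagonal_one, Matrix.diagonal_sub, ← Matrix.diagonal_smul]
    rfl
  rw [covD, fdiff, e, Matrix.smul_mul, Matrix.sub_mul, Matrix.one_mul, ← smul_add]
  congr 1
  abel

/-- `∇^1_ν = ∇_ν`. [folklore] -/
theorem covD_one (c : ℂ) (ν : Fin d) : covD Nf c 1 ν = fdiff Nf c ν := by
  have h1 : (1 : Fin d → (Tor Nf × Fin d → ℂ)) ν = fun _ => 1 := rfl
  rw [covD, h1, Matrix.diagonal_one, Matrix.one_mul, fdiff]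

/-- **the abelian covariant vector Laplacian** `Δ^U = Σ_ν (∇^U_ν)ᴴ·∇^U_ν`. [folklore] -/
def covLap (c : ℂ) (u : Fin d → (Tor Nf × Fin d → ℂ)) : Matrix (Tor Nf × Fin d) (Tor Nf × Fin d) ℂ :=
  ∑ ν, (covD Nf c u ν)ᴴ * covD Nf c u ν

/-- the free nearest-neighbour vector Laplacian `Δ^1 = Σ_ν ∇_νᴴ·∇_ν`. [folklore] -/
def lap (c : ℂ) : Matrix (Tor Nf × Fin d) (Tor Nf × Fin d) ℂ := ∑ ν, (fdiff Nf c ν)ᴴ * fdiff Nf c ν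

/-- `Δ^1 = Δ^U` at `U = 1`. [folklore] -/
theorem covLap_one (c : ℂ) : covLap Nf c 1 = lap Nf c := by
  simp only [covLap, lap, covD_one]

/-- the zeroth-order coefficient field `z = Σ_ν [|w_ν|² ∘ τ_ν⁻¹ − c(w_ν − w_ν∘τ_ν⁻¹) − c(w̄_ν − w̄_ν∘τ_ν⁻¹)]`. [folklore] -/
def zfield (c : ℂ) (u : Fin d → (Tor Nf × Fin d → ℂ)) : Tor Nf × Fin d → ℂ := fun i =>
  ∑ ν, (star (conn Nf c u ν (tauInv Nf ν i)) * conn Nf c u ν (tauInv Nf ν i)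
    - c * (conn Nf c u ν i - conn Nf c u ν (tauInv Nf ν i)) - c * (star (conn Nf c u ν i) - star (conn Nf c u ν (tauInv Nf ν i))))

/-- the first-order coefficient field `−w`. [folklore] -/
def negConn (c : ℂ) (u : Fin d → (Tor Nf × Fin d → ℂ)) : Fin d → (Tor Nf × Fin d → ℂ) := fun ν i => -(conn Nf c u ν i)

omit hNf in
/-- `Σ_ν diag(f_ν) = diag(Σ_ν f_ν)`. [folklore] -/
theorem sum_diagonal (f : Fin d → (Tor Nf × Fin d → ℂ)) :
    ∑ ν, Matrix.diagonal (f ν) = Matrix.diagonal (fun i => ∑ ν, f ν i) := by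
  ext i j
  rw [Matrix.sum_apply]
  by_cases h : i = j
  · subst h; simp only [Matrix.diagonal_apply_eq]
  · simp only [Matrix.diagonal_apply_ne _ h, Finset.sum_const_zero]

end OneLevel

/-! ## §2 The exact decomposition `Δ^U − Δ^1 = F + Fᴴ + diag z` (real lattice factor) -/

/-- `star (n : ℂ) = n`. [folklore] -/
theorem star_natCast_complex (n : ℕ) : star ((n : ℕ) : ℂ) = ((n : ℕ) : ℂ) := by
  rw [Complex.star_def, map_natCast]

section Level

variable (n : ℕ) [NeZero n] (M : Fin d → ℕ) [hM : ∀ μ, NeZero (M μ)]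

/-- **`∇ᴴ·diag(w)·S = −diag(w)·∇ − c·(diag w − diag(w ∘ τ⁻¹))`** (real `c = n`). [folklore] -/
theorem fdiffH_mul_diag_shift (ν : Fin d) (w : Tor (fine n M) × Fin d → ℂ) :
    (fdiff (fine n M) ((n : ℕ) : ℂ) ν)ᴴ * (Matrix.diagonal w * shiftM (fine n M) ν)
      = -(Matrix.diagonal w * fdiff (fine n M) ((n : ℕ) : ℂ) ν)
        - ((n : ℕ) : ℂ) • (Matrix.diagonal w - Matrix.diagonal (fun i => w (tauInv (fine n M) ν i))) := by
  rw [fdiff, Matrix.conjTranspose_smul, star_natCast_complex, Matrix.conjTranspose_sub, Matrix.conjTranspose_one, Matrix.smul_mul,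
    Matrix.sub_mul, Matrix.one_mul, conjTranspose_shiftM_mul_diagonal_mul_shiftM, Matrix.mul_smul, Matrix.mul_sub, Matrix.mul_one,
    smul_sub, smul_sub, smul_sub]
  abel

/-- `(diag(w)S)ᴴ·(diag(w)S) = diag(|w|² ∘ τ⁻¹)`. [folklore] -/
theorem diag_shift_sq (ν : Fin d) (w : Tor (fine n M) × Fin d → ℂ) :
    (Matrix.diagonal w * shiftM (fine n M) ν)ᴴ * (Matrix.diagonal w * shiftM (fine n M) ν)
      = Matrix.diagonal (fun i => star (w (tauInv (fine n M) ν i)) * w (tauInv (fine n M) ν i)) := by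
  rw [Matrix.conjTranspose_mul, Matrix.diagonal_conjTranspose, Matrix.mul_assoc,
    ← Matrix.mul_assoc (Matrix.diagonal (star w)) (Matrix.diagonal w), Matrix.diagonal_mul_diagonal,
    conjTranspose_shiftM_mul_diagonal_mul_shiftM]
  rfl

/-- per direction: `(∇^U_ν)ᴴ∇^U_ν − ∇_νᴴ∇_ν = diag(−w)∇ + (diag(−w)∇)ᴴ + [diag(|w|²∘τ⁻¹) − c(D − D₋) − c(D̄ − D̄₋)]`. [folklore] -/
theorem covD_sq_sub_dir (u : Fin d → (Tor (fine n M) × Fin d → ℂ)) (ν : Fin d) :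
    (covD (fine n M) ((n : ℕ) : ℂ) u ν)ᴴ * covD (fine n M) ((n : ℕ) : ℂ) u ν
        - (fdiff (fine n M) ((n : ℕ) : ℂ) ν)ᴴ * fdiff (fine n M) ((n : ℕ) : ℂ) ν
      = Matrix.diagonal (negConn (fine n M) ((n : ℕ) : ℂ) u ν) * fdiff (fine n M) ((n : ℕ) : ℂ) ν
        + (Matrix.diagonal (negConn (fine n M) ((n : ℕ) : ℂ) u ν) * fdiff (fine n M) ((n : ℕ) : ℂ) ν)ᴴ
        + (Matrix.diagonal (fun i => star (conn (fine n M) ((n : ℕ) : ℂ) u ν (tauInv (fine n M) ν i))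
              * conn (fine n M) ((n : ℕ) : ℂ) u ν (tauInv (fine n M) ν i))
            - ((n : ℕ) : ℂ) • (Matrix.diagonal (conn (fine n M) ((n : ℕ) : ℂ) u ν)
                - Matrix.diagonal (fun i => conn (fine n M) ((n : ℕ) : ℂ) u ν (tauInv (fine n M) ν i)))
            - ((n : ℕ) : ℂ) • (Matrix.diagonal (star (conn (fine n M) ((n : ℕ) : ℂ) u ν))
                - Matrix.diagonal (star (fun i => conn (fine n M) ((n : ℕ) : ℂ) u ν (tauInv (fine n M) ν i))))) := by
  set c : ℂ := ((n : ℕ) : ℂ) with hc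
  set w := conn (fine n M) c u ν with hw
  set S := shiftM (fine n M) ν with hS
  set D := Matrix.diagonal w with hD
  set G := fdiff (fine n M) c ν with hG
  have hneg : Matrix.diagonal (negConn (fine n M) c u ν) = -D := by
    rw [hD, Matrix.diagonal_neg]; rfl
  have hB : Gᴴ * (D * S) = -(D * G) - c • (D - Matrix.diagonal (fun i => w (tauInv (fine n M) ν i))) :=
    fdiffH_mul_diag_shift n M ν w
  have hBt : (D * S)ᴴ * G = (-(D * G) - c • (D - Matrix.diagonal (fun i => w (tauInv (fine n M) ν i))))ᴴ := by
    rw [← hB, Matrix.conjTranspose_mul Gᴴ (D * S), Matrix.conjTranspose_conjTranspose]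
  have hC : (D * S)ᴴ * (D * S) = Matrix.diagonal (fun i => star (w (tauInv (fine n M) ν i)) * w (tauInv (fine n M) ν i)) :=
    diag_shift_sq n M ν w
  have hstar : star c = c := star_natCast_complex n
  rw [covD_eq, ← hG, ← hw, ← hD, ← hS, Matrix.conjTranspose_add, Matrix.add_mul, Matrix.mul_add, Matrix.mul_add, hBt, hB, hC, hneg,
    Matrix.conjTranspose_sub, Matrix.conjTranspose_neg, Matrix.conjTranspose_smul, hstar, Matrix.conjTranspose_sub,
    Matrix.diagonal_conjTranspose, Matrix.diagonal_conjTranspose, Matrix.neg_mul, Matrix.conjTranspose_neg]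
  abel

/-- **THE EXACT DECOMPOSITION `Δ^U − Δ^1 = F + Fᴴ + diag z`**, `F = Σ_ν diag(−w_ν)∇_ν`. [folklore] -/
theorem covLap_sub_lap_eq (u : Fin d → (Tor (fine n M) × Fin d → ℂ)) :
    covLap (fine n M) ((n : ℕ) : ℂ) u - lap (fine n M) ((n : ℕ) : ℂ)
      = firstOrder (fine n M) ((n : ℕ) : ℂ) (negConn (fine n M) ((n : ℕ) : ℂ) u)
        + (firstOrder (fine n M) ((n : ℕ) : ℂ) (negConn (fine n M) ((n : ℕ) : ℂ) u))ᴴ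
        + Matrix.diagonal (zfield (fine n M) ((n : ℕ) : ℂ) u) := by
  rw [covLap, lap, ← Finset.sum_sub_distrib, Finset.sum_congr rfl fun ν _ => covD_sq_sub_dir n M u ν, Finset.sum_add_distrib,
    Finset.sum_add_distrib, firstOrder, ← Matrix.conjTranspose_sum]
  congr 1
  unfold zfield
  rw [← sum_diagonal]
  refine Finset.sum_congr rfl fun ν _ => ?_
  rw [Matrix.diagonal_sub, Matrix.diagonal_sub, ← Matrix.diagonal_smul, ← Matrix.diagonal_smul, Matrix.diagonal_sub,
    Matrix.diagonal_sub]
  rfl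

end Level

/-! ## §3 Along the tower: `PerturbationLaws` and the η-rate -/

section Tower

variable (L : ℕ) [NeZero L] (M : Fin d → ℕ) [hM : ∀ μ, NeZero (M μ)] (a : ℝ) (ha : 0 < a)

/-- the perturbation family `P_k = Δ^{U_k} − Δ^1` at spacing `L^{−k}` for a tower of transporters `u^{(k)}`. [folklore] -/
def covPert (u : (k : ℕ) → Fin d → (idx L M k → ℂ)) (k : ℕ) : Matrix (idx L M k) (idx L M k) ℂ :=
  covLap (fine (lev L k) M) ((lev L k : ℕ) : ℂ) (u k) - lap (fine (lev L k) M) ((lev L k : ℕ) : ℂ)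

/-- the first-order coefficient fields `−w^{(k)}` along the tower. [folklore] -/
def connV (u : (k : ℕ) → Fin d → (idx L M k → ℂ)) (k : ℕ) : Fin d → (idx L M k → ℂ) :=
  negConn (fine (lev L k) M) ((lev L k : ℕ) : ℂ) (u k)

/-- the zeroth-order coefficient fields `z^{(k)}` along the tower. [folklore] -/
def zT (u : (k : ℕ) → Fin d → (idx L M k → ℂ)) (k : ℕ) : idx L M k → ℂ :=
  zfield (fine (lev L k) M) ((lev L k : ℕ) : ℂ) (u k)

/-- `P_k = F_k + F_kᴴ + diag z^{(k)}` with `F_k = Pmodel (connV u) k`. [folklore] -/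
theorem covPert_eq (u : (k : ℕ) → Fin d → (idx L M k → ℂ)) (k : ℕ) :
    covPert L M u k = Pmodel L M (connV L M u) k + (Pmodel L M (connV L M u) k)ᴴ + Matrix.diagonal (zT L M u k) :=
  covLap_sub_lap_eq (lev L k) M (u k)

/-- **`PerturbationLaws` FOR THE ABELIAN COVARIANT LAPLACIAN** (`d ≥ 1`): if `−w^{(k)}` is a `LipschitzBackground (α, β)` and
`z^{(k)}` a `BoundedBackground (α′, β′)`, then `k ↦ Δ^{U_k} − Δ^1` satisfies `PerturbationLaws` w.r.t. `Δ_a`, King's pairing,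
`κ = 2d(α + β)Cst + α′Cst`, `e₂ k = (C₂ + C₂ᴴ + Cst²β′)·L^{−k}`. [folklore] -/
theorem perturbationLaws_covariantLaplacian (hd : 1 ≤ d) {u : (k : ℕ) → Fin d → (idx L M k → ℂ)} {α β α' β' : ℝ}
    (hV : LipschitzBackground L M (connV L M u) α β) (hz : BoundedBackground L M (zT L M u) α' β') :
    PerturbationLaws (calDalev L M a ha) (covPert L M u) (JpcT L M) (2 * (d * (α + β) * Cst d a) + α' * Cst d a)
      (fun k => (C2model d L a α β + C2adj d L a α β + Cst d a * β' * Cst d a) * ((L : ℝ)⁻¹) ^ k) := by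
  have h := perturbationLaws_add (perturbationLaws_selfAdjointFirstOrder L M a ha hd hV) (perturbationLaws_zerothOrder L M a ha hz)
  have e : covPert L M u = fun k => Pmodel L M (connV L M u) k + (Pmodel L M (connV L M u) k)ᴴ + Matrix.diagonal (zT L M u k) :=
    funext fun k => covPert_eq L M u k
  rw [e]
  refine perturbationLaws_mono h le_rfl fun k => le_of_eq ?_
  ring

/-- **η-RATE FOR THE ABELIAN COVARIANT LAPLACIAN COUPLING** (`L ≥ 2`, `d ≥ 1`): for every `‖t‖κ < 1` the King-averaged unit-lattice
covariances of `(Δ_a^{(k)} + t(Δ^{U_k} − Δ^1))⁻¹` converge with rate `L^{−k}`. [cite: King1986, Lemma 4.5 (4.32)/(4.38) p.674;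
Balaban1985BackgroundPropagators, (3.3) p.390 (shape)] [folklore] -/
theorem towerLimitRate_covariantLaplacian (hL : 2 ≤ L) (hd : 1 ≤ d) {u : (k : ℕ) → Fin d → (idx L M k → ℂ)}
    {α β α' β' : ℝ} (hV : LipschitzBackground L M (connV L M u) α β) (hz : BoundedBackground L M (zT L M u) α' β') {t : ℂ}
    (ht : ‖t‖ * (2 * (d * (α + β) * Cst d a) + α' * Cst d a) < 1) :
    TowerLimitRate (Qlev L M) ((L : ℝ) ^ d) (fun k => (calDalev L M a ha k + t • covPert L M u k)⁻¹)
      (Cpert (2 * (d * (α + β) * Cst d a) + α' * Cst d a) (2 * d * Cst d a) (CJ d a)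
        (C2model d L a α β + C2adj d L a α β + Cst d a * β' * Cst d a) 0 t) ((L : ℝ)⁻¹) :=
  towerLimitRate_perturbed_king L M a ha hL (perturbationLaws_covariantLaplacian L M a ha hd hV hz) ht

/-- **THE η-RATE AT THE PHYSICAL VALUE `t = 1`** in the small-field regime `κ = 2d(α + β)Cst + α′Cst < 1`: the King-averaged
unit-lattice covariances `c_k` of `(Δ_a^{(k)} + Δ^{U_k} − Δ^1)⁻¹` CONVERGE with `‖c_k − c_∞‖ ≤ Cpert(1)·L^{−k}/(1 − L^{−1})`.
Statement, pairing and constants OURS. [cite: King1986, Lemma 4.5 p.674; Balaban1985BackgroundPropagators, (3.3) p.390] [folklore] -/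
theorem covariantLaplacian_rate (hL : 2 ≤ L) (hd : 1 ≤ d) {u : (k : ℕ) → Fin d → (idx L M k → ℂ)} {α β α' β' : ℝ}
    (hV : LipschitzBackground L M (connV L M u) α β) (hz : BoundedBackground L M (zT L M u) α' β')
    (hsmall : 2 * (d * (α + β) * Cst d a) + α' * Cst d a < 1) :
    TowerLimitRate (Qlev L M) ((L : ℝ) ^ d) (fun k => (calDalev L M a ha k + covPert L M u k)⁻¹)
      (Cpert (2 * (d * (α + β) * Cst d a) + α' * Cst d a) (2 * d * Cst d a) (CJ d a)
        (C2model d L a α β + C2adj d L a α β + Cst d a * β' * Cst d a) 0 1) ((L : ℝ)⁻¹) := by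
  have h := towerLimitRate_covariantLaplacian L M a ha hL hd hV hz (t := 1) (by rwa [norm_one, one_mul])
  simpa only [one_smul] using h

/-- the same with named limits and the Lipschitz bound in the coupling (from `ne2Plus_resolvent_route`). [folklore] -/
theorem covariantLaplacian_limit (hL : 2 ≤ L) (hd : 1 ≤ d) {u : (k : ℕ) → Fin d → (idx L M k → ℂ)} {α β α' β' : ℝ}
    (hV : LipschitzBackground L M (connV L M u) α β) (hz : BoundedBackground L M (zT L M u) α' β') {t : ℂ}
    (ht : ‖t‖ * (2 * (d * (α + β) * Cst d a) + α' * Cst d a) < 1) :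
    ∃ ct c0 : Matrix (idx L M 0) (idx L M 0) ℂ,
      Tendsto (pertCov L M a ha (covPert L M u) t) atTop (𝓝 ct) ∧ Tendsto (pertCov L M a ha (covPert L M u) 0) atTop (𝓝 c0) ∧
      (∀ k, ‖pertCov L M a ha (covPert L M u) t k - ct‖
          ≤ Cpert (2 * (d * (α + β) * Cst d a) + α' * Cst d a) (2 * d * Cst d a) (CJ d a)
              (C2model d L a α β + C2adj d L a α β + Cst d a * β' * Cst d a) 0 t * ((L : ℝ)⁻¹) ^ k / (1 - (L : ℝ)⁻¹)) ∧
      ‖ct - c0‖ ≤ ‖t‖ * (2 * (d * (α + β) * Cst d a) + α' * Cst d a) * Cst d a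
        * (1 - ‖t‖ * (2 * (d * (α + β) * Cst d a) + α' * Cst d a))⁻¹ :=
  ne2Plus_resolvent_route L M a ha hL (perturbationLaws_covariantLaplacian L M a ha hd hV hz) ht

end Tower

end Summit.QuantumFields.BalabanUV.T4Continuum.AbelianCovariantLaplacian

end
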